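import Summits.CriticalPhenomena.PercolationContinuityZ3.Theorems.Transplant.D10SKc01_3355P2
import HarnessLib

/-!
# Diamond film `D_10` — KERNEL CERTIFICATE for the class `01_3355` of `ShapedLinkageX 4 (DiamondFilm.sqShadow (k := 10))`, THE CLASS (mask + coverage from the 2 parts) (template `evenmcp`, |W| = 119, 2450 terminal pairs, 7190 plans)

builds on p205010 (kernel theorem, internal audit signed; external expert review pending) — NOT used in this file.  Lane `prim-bschramm`, seat `prim-bschramm-p2` (gen 43; class C1b;
memo `HOME/bschramm/P2-LATTICES.md` §152); helper file (`--supports stmt-CriticalPhenomena-4575 --as helper`).  Generated by `cert/emit_dk.py` from the plans of `cert/gen_dk.py`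
(canonical BFS routings with avoid hints, exact mirror `cert/kern_dk.py` of «DkSKDefs»); re-checked here by the kernel (`DCtx.checkEs`); `caseOK_k10_01_3355` feeds «D10SKFinal».
[cite: DuminilCopinSidoraviciusTassion2016, §2.3 (proof of Fact 2: the three disjoint paths in B_R(z))]
-/

namespace Summit.CriticalPhenomena.PercolationContinuityZ3.Theorems.Transplant

namespace DiamondFilm.DK

/-- The cleared mask of the class `01_3355` of `D_10` is admissible (inside the cleared block, containing the forced core). [folklore] -/
theorem wOK_k10_01_3355 : DCtx.wOK (⟨10, 0, 1, 3, 3, 5, 5, 770763688173884658123054275738584765983412921128871255752343446560812979530020520552190574385958686111974281609216⟩ : DCtx) = true := by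
  decide +kernel

/-- **THE CLASS `01_3355` OF `D_10` IS COVERED**: every needed bit of every certified terminal pair has a swap-pair plan. [cite: DuminilCopinSidoraviciusTassion2016, §2.3 (proof of Fact 2)] -/
theorem caseOK_k10_01_3355 : CaseOK (⟨10, 0, 1, 3, 3, 5, 5, 770763688173884658123054275738584765983412921128871255752343446560812979530020520552190574385958686111974281609216⟩ : DCtx) :=
  caseOK_of_chunks _ [[15, 17, 19, 26, 28, 30], [32, 50, 56, 74, 76, 78], [80, 87, 89, 91, 159, 160], [161, 162, 163, 170, 176, 182], [188, 194, 200, 206, 212, 218], [224, 231, 232, 233, 234, 235], [304, 306, 314, 320, 326, 332], [338, 344, 350, 356, 362, 368], [376, 378]]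
    (List.forall_mem_cons.2 ⟨checkEs_sound _ _ _ chunk_k10_01_3355_0, List.forall_mem_cons.2 ⟨checkEs_sound _ _ _ chunk_k10_01_3355_1, List.forall_mem_cons.2 ⟨checkEs_sound _ _ _ chunk_k10_01_3355_2, List.forall_mem_cons.2 ⟨checkEs_sound _ _ _ chunk_k10_01_3355_3, List.forall_mem_cons.2 ⟨checkEs_sound _ _ _ chunk_k10_01_3355_4, List.forall_mem_cons.2 ⟨checkEs_sound _ _ _ chunk_k10_01_3355_5, List.forall_mem_cons.2 ⟨checkEs_sound _ _ _ chunk_k10_01_3355_6, List.forall_mem_cons.2 ⟨checkEs_sound _ _ _ chunk_k10_01_3355_7, List.forall_mem_cons.2 ⟨checkEs_sound _ _ _ chunk_k10_01_3355_8, List.forall_mem_nil _⟩⟩⟩⟩⟩⟩⟩⟩⟩)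
    (by decide +kernel)

end DiamondFilm.DK

end Summit.CriticalPhenomena.PercolationContinuityZ3.Theorems.Transplant
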